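import Summits.CriticalPhenomena.PercolationContinuityZ3.Theorems.PercNearOneGluingNoHeavyQuantCatHullStep
import Summits.CriticalPhenomena.PercolationContinuityZ3.Theorems.PercNearOneGluingNoHeavyQuantGatedCatHullClosure
import HarnessLib

/-!
# QUANT lane R8, T-DEC: THE LIGHT CATERPILLAR-HULL NODE SPLITS INTO THREE SUB-STATEMENTS —
# `TreeBuiltCatHullLight ⟸ CatPairLight ∧ HeavyGateLight ∧ HeavyBelowHalf` (and conversely each is a family of its instances)

builds on p205010 (kernel theorem, internal audit signed; external expert review pending)

Statement + support file (`--supports stmt-CriticalPhenomena-4575`), QUANT lane lead seat prim-quant-lead (gen 47), rung R8 of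
`run/shared/lean/prim/quant/LADDER.md`; README V430–V432, census-2 g75's decomposition (INBOX 2026-08-26T04:44Z, "(P) ∧ (G) ∧ (M)"),
the lead's LEAD-NOTES-G47 A2/A3.  Three `@[conjecture]` definitions — each a FAMILY OF INSTANCES of the typed node
`LawDec.TreeBuiltCatHullLight` (typer g41 ✓ p419856), typed separately so that the three censuses and the three proof efforts attach to
names — and the reduction theorem; standard axioms, no sorries.

THE SPLIT.  Induct on a `TreeBuilt x M μ` derivation with the invariant
  Φ(x, M, μ) := ∀ q ∈ (0,1], ∀ x′ ∈ (0, 1/2) with x′ ≤ q·x:  gate μ q ∈ FH(x′, q·mean μ, M)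
(FH = `InGatedCatHull`).  `nil`/`relay` are caterpillars; `mono` and `gate` are bookkeeping (`gate_gate`); the only real case is `conv`:
gate_q(μ₁ ∗ μ₂) at a light floor x′ ≤ q·x.  If x′/q < 1/2, both factors are members at x′/q (invariant with the unit gate), their product is a
member by the PAIR LEMMA at the light floor x′/q (**(P) `CatPairLight`**, through `InGatedCatHull.lconv_of_pairs`: closure under independent
joins reduces to pairs of caterpillar COLUMNS), and gating by q lands at x′ (`inGatedCatHull_gate`).  If x′/q ≥ 1/2 the product ν = μ₁ ∗ μ₂ is a
HEAVY tree-built law (floor x ≥ 1/2) and no hull information about ν is available (the hull fails for some heavy laws at their natural floor,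
README V431): either q·x < 1/2 and **(G) `HeavyGateLight`** gives gate ν q ∈ FH(q·x) (then lower the floor to x′), or q·x ≥ 1/2, gate ν q is itself
heavy, and **(M) `HeavyBelowHalf`** gives it at every light floor.  So `TreeBuiltCatHullLight ⟸ (P) ∧ (G) ∧ (M)`
(`treeBuiltCatHullBelow_half_of_split`); conversely (G) and (M) are literally instances of the node (`TreeBuilt.gate` resp. `TreeBuilt.mono` to
the light floor; one-liners against `TreeBuiltCatHullLight` once its olean is on the farm), and (P) restricted to tree-built columns is too —
nothing is lost, and each part has its own census:
(P) light products 159/159 + 36/36 + the lead's groups D/E/S (census-2 g74/g75, lead g47), (M) the seven heavy free-hull failures read at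
floors ≤ 1/2: 24/24 IN by gated blob forests (census-2 g75 kit j249089–91; lead g47 groups B/J 31/31), (G) the same under light-making outer
gates: all IN, a*(F) ≥ .999 (census-2 g75 kit j248949/50; lead g47 group H 16/16).  HONEST STATUS: all four statements are evidence-level
conjectures; `SiblingStep`/`GateStepN`/`FarTreeRow` OPEN; RATE class log\* / honest sentence of `run/shared/lean/prim/quant/README.md`
unchanged.

* `@[conjecture] LawDec.CatPairLight` — (P): for caterpillar columns `gate P s`, `gate Q t` at a light floor `y < 1/2`, the product is in
  `FH(y, s·mean P + t·mean Q, N₁ + N₂)`.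
* `@[conjecture] LawDec.HeavyGateLight` — (G): `TreeBuilt x M ν`, `1/2 ≤ x`, `0 < q`, `q·x < 1/2` ⟹ `gate ν q ∈ FH(q·x, q·mean ν, M)`.
* `@[conjecture] LawDec.HeavyBelowHalf` — (M): `TreeBuilt x M ν`, `1/2 ≤ x` ⟹ `ν ∈ FH(x′, mean ν, M)` for every `0 < x′ < 1/2`.
* **`treeBuiltCatHullBelow_half_of_split : CatPairLight → HeavyGateLight → HeavyBelowHalf → (∀ TreeBuilt x M μ, x < 1/2 → member)`** —
  the conclusion is LITERALLY the body of `LawDec.TreeBuiltCatHullBelow (1/2) = TreeBuiltCatHullLight` (typer g41 `…QuantCatHullLight`, whose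
  olean the check farm had not built when this file was written — hence stated unfolded; `farTreeRow_of_treeBuiltCatHullLight` then gives
  `Quant.FarTreeRow` in one line).

[this work]; decomposition: prim-quant-census-2 g75 and the lead independently; hull API: prim-quant-stmt g41, prim-quant-census-1 g23,
prim-quant-census-2 g74.  Nothing here is cited as a published result.  The gluing rows served [cite: KozmaNitzan2024, Conjecture 3 (p. 15)];
product measure [cite: Grimmett1999, §1.3 p. 10].
-/

noncomputable section

open scoped BigOperators

namespace Summit.CriticalPhenomena.PercolationContinuityZ3.Theorems
namespace Quant
namespace LawDec

open Finset

/-! ### The three sub-statements -/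

/-- **CONJECTURE (P), THE PAIR LEMMA AT LIGHT FLOORS (census-2 g74 FREEHULL-G74 §5; lead g47 V430).**  For every light floor `0 < y < 1/2` and
every two gated caterpillar columns `gate P s`, `gate Q t` at floor `y` (`y < s, t ≤ 1`, `CatBuilt (y/s) N₁ P`, `CatBuilt (y/t) N₂ Q`), the
independent join `lconv N₁ N₂ (gate P s) (gate Q t)` lies in the gated caterpillar hull at floor `y` and mean `s·mean P + t·mean Q`.  By
`InGatedCatHull.lconv_of_pairs` this is closure of `FH(y)` under independent joins.  EVIDENCE: every light product tested is a member
(census-2 g74/g75 159/159 + 36/36 at a = 1; lead g47 CENSUS-CATHULL-G47 groups D/E/S/K); note the columns may be heavy laws read at the light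
floor (e.g. `(R¹[.95](R³[11/19]))²`, natural floor .55, is OUT at .55 but IN at .54 … .45).  ADVERSE: none at light floors; FALSE at heavy
floors (`(R¹[q](R³[x/q]))²` is OUT at its natural floor for every tested `x ≥ .505`, lead g47 kit j249713–5).
builds on p205010 (kernel theorem, internal audit signed; external expert review pending). [this work] [status: open] -/
@[conjecture] def CatPairLight : Prop :=
  ∀ (y s t : ℝ) (N₁ N₂ : ℕ) (P Q : ℕ → ℝ), 0 < y → y < 1 / 2 → y < s → s ≤ 1 → y < t → t ≤ 1 →
    CatBuilt (y / s) N₁ P → CatBuilt (y / t) N₂ Q →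
    InGatedCatHull y (s * (∑ h ∈ Finset.range (N₁ + 1), (h : ℝ) * P h) + t * (∑ h ∈ Finset.range (N₂ + 1), (h : ℝ) * Q h))
      (N₁ + N₂) (lconv N₁ N₂ (gate P s) (gate Q t))

/-- **CONJECTURE (G), LIGHT GATES OF HEAVY LAWS (census-2 g75; lead g47 group H).**  A tree-built law `ν` at a HEAVY floor `x ≥ 1/2`, hung under
an outer gate `q` that makes the floor light (`q·x < 1/2`), is a member of the gated caterpillar hull at floor `q·x` and mean `q·mean ν`.
This is programme (I) of README V428 at the light levels; it is NOT implied by hull membership of `ν` (which may fail at a heavy natural floor):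
e.g. `F = (R¹[.97](R³[3/5]))³ ∉ FH(.582)` (census-2 g74) while `gate F (17/20) ∈ FH(.4947)` by pure gated blobs (lead g47).  EVIDENCE: the seven
heavy free-hull failures under a ∈ {1/2, …, .99, .999}: all IN (census-2 g75 kit j248949/50); lead g47 group H 16/16 IN.  ADVERSE: none.
builds on p205010 (kernel theorem, internal audit signed; external expert review pending). [this work] [status: open] -/
@[conjecture] def HeavyGateLight : Prop :=
  ∀ (x : ℝ) (M : ℕ) (ν : ℕ → ℝ), TreeBuilt x M ν → 1 / 2 ≤ x → ∀ q : ℝ, 0 < q → q * x < 1 / 2 →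
    InGatedCatHull (q * x) (q * ∑ h ∈ Finset.range (M + 1), (h : ℝ) * ν h) M (gate ν q)

/-- **CONJECTURE (M), HEAVY LAWS AT LIGHT FLOORS (census-2 g75; lead g47 groups B/J).**  A tree-built law `ν` at a heavy floor `x ≥ 1/2` is a
member of the gated caterpillar hull at every light floor `0 < x′ < 1/2` (mean `mean ν`, top `M`) — the `TreeBuilt.mono` instances of the light
node crossing `1/2`.  EVIDENCE: the heavy free-hull failures read at floors ≤ 1/2: 24/24 IN by gated blob forests (census-2 g75 kit j249089–91);
lead g47: heavy gapped cores re-declared at .49/.45/.40/.30 (12/12, blobs) and at .005/.01/.02 below their natural floors (19/19).  ADVERSE: none.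
builds on p205010 (kernel theorem, internal audit signed; external expert review pending). [this work] [status: open] -/
@[conjecture] def HeavyBelowHalf : Prop :=
  ∀ (x : ℝ) (M : ℕ) (ν : ℕ → ℝ), TreeBuilt x M ν → 1 / 2 ≤ x → ∀ x' : ℝ, 0 < x' → x' < 1 / 2 →
    InGatedCatHull x' (∑ h ∈ Finset.range (M + 1), (h : ℝ) * ν h) M ν

/-! ### The reduction -/

/-- the unit relay gated by `q` is the one-blob slice of the tip: `gate δ₁ q = slice δ₀ 1 q`. [this work] -/
theorem gate_relay_eq_slice (q : ℝ) :
    gate (fun h => if h = 1 then (1 : ℝ) else 0) q = slice (fun h => if h = 0 then (1 : ℝ) else 0) 1 q := by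
  funext h
  simp only [gate, slice]
  rcases Nat.lt_or_ge h 1 with h0 | h1
  · have : h = 0 := by omega
    subst this; simp
  · rcases Nat.lt_or_ge h 2 with h1' | h2
    · have : h = 1 := by omega
      subst this; simp
    · simp [show h ≠ 1 by omega, show h ≠ 0 by omega, show 1 ≤ h by omega, show h - 1 ≠ 0 by omega]

/-- **THE INVARIANT.**  Under (P), (G), (M): for every tree-built law `μ` at floor `x`, every outer gate `0 < q ≤ 1` and every LIGHT floor
`0 < x′ < 1/2` with `x′ ≤ q·x`, the gated law `gate μ q` is a member of the gated caterpillar hull at `(x′, q·mean μ, M)`. [this work] -/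
theorem treeBuilt_gate_inGatedCatHull_of_split (hP : CatPairLight) (hG : HeavyGateLight) (hM : HeavyBelowHalf)
    {x : ℝ} {M : ℕ} {μ : ℕ → ℝ} (hT : TreeBuilt x M μ) :
    ∀ (q x' : ℝ), 0 < q → q ≤ 1 → 0 < x' → x' ≤ q * x → x' < 1 / 2 →
      InGatedCatHull x' (q * ∑ h ∈ Finset.range (M + 1), (h : ℝ) * μ h) M (gate μ q) := by
  induction hT with
  | nil x₀ hx0 hx1 =>
    intro q x' hq0 hq1 hx'0 hx'q hx'
    -- `gate δ₀ q = δ₀`, a caterpillar tip at floor `x'`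
    have e : gate (fun h => if h = 0 then (1 : ℝ) else 0) q = fun h => if h = 0 then (1 : ℝ) else 0 := by
      funext h; simp only [gate]; split_ifs <;> ring
    have key := inGatedCatHull_of_catBuilt (CatBuilt.nil x' hx'0 (by linarith))
    rw [e]
    convert key using 1
    simp
  | relay x₀ hx0 hx1 =>
    intro q x' hq0 hq1 hx'0 hx'q hx'
    have hxq : x' ≤ q := by nlinarith
    have hC : CatBuilt x' (0 + 1) (slice (fun h => if h = 0 then (1 : ℝ) else 0) 1 q) :=
      (CatBuilt.nil x' hx'0 (by linarith)).slice 1 q hxq hq1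
    have key := inGatedCatHull_of_catBuilt hC
    rw [gate_relay_eq_slice]
    convert key using 1
    simp [Finset.sum_range_succ, slice]
  | @conv x₀ M₁ M₂ μ₁ μ₂ h₁ h₂ ih₁ ih₂ =>
    intro q x' hq0 hq1 hx'0 hx'q hx'
    obtain ⟨hx0, hx1, n1, z1, s1, _⟩ := treeBuilt_lawFacts h₁
    obtain ⟨_, _, n2, z2, s2, _⟩ := treeBuilt_lawFacts h₂
    have hmean : ∑ h ∈ Finset.range (M₁ + M₂ + 1), (h : ℝ) * lconv M₁ M₂ μ₁ μ₂ h =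
        ∑ h ∈ Finset.range (M₁ + 1), (h : ℝ) * μ₁ h + ∑ h ∈ Finset.range (M₂ + 1), (h : ℝ) * μ₂ h :=
      sum_mul_lconv M₁ M₂ μ₁ μ₂ s1 s2
    by_cases hA : x' / q < 1 / 2
    · -- case A: both factors are members at the light floor `x'/q`; pair lemma there; gate by `q`
      have hxq' : x' / q ≤ 1 * x₀ := by rw [one_mul, div_le_iff₀ hq0]; linarith [mul_comm q x₀]
      have m₁ := ih₁ 1 (x' / q) one_pos le_rfl (div_pos hx'0 hq0) hxq' hA
      have m₂ := ih₂ 1 (x' / q) one_pos le_rfl (div_pos hx'0 hq0) hxq' hA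
      rw [gate_one, one_mul] at m₁ m₂
      have hpair := fun (s t : ℝ) (N₁ N₂ : ℕ) (P Q : ℕ → ℝ) (hys : x' / q < s) (hs1 : s ≤ 1) (hyt : x' / q < t) (ht1 : t ≤ 1)
          (hCP : CatBuilt (x' / q / s) N₁ P) (hCQ : CatBuilt (x' / q / t) N₂ Q) =>
        hP (x' / q) s t N₁ N₂ P Q (div_pos hx'0 hq0) hA hys hs1 hyt ht1 hCP hCQ
      have prod := InGatedCatHull.lconv_of_pairs hpair (div_pos hx'0 hq0) m₁ m₂
      have key := inGatedCatHull_gate prod (div_pos hx'0 hq0).le q hq0 hq1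
      rw [mul_div_cancel₀ x' hq0.ne'] at key
      rw [hmean]
      exact key
    · -- case B: the product is heavy
      have hA' : 1 / 2 ≤ x' / q := not_lt.1 hA
      have hxheavy : 1 / 2 ≤ x₀ := by
        have : x' / q ≤ x₀ := by rw [div_le_iff₀ hq0]; linarith [mul_comm q x₀]
        linarith
      have hν : TreeBuilt x₀ (M₁ + M₂) (lconv M₁ M₂ μ₁ μ₂) := TreeBuilt.conv h₁ h₂
      by_cases hB : q * x₀ < 1 / 2
      · have key := hG x₀ (M₁ + M₂) _ hν hxheavy q hq0 hB
        exact key.mono hx'0 hx'q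
      · have hν' : TreeBuilt (q * x₀) (M₁ + M₂) (gate (lconv M₁ M₂ μ₁ μ₂) q) := TreeBuilt.gate q hq0 hq1 hν
        have key := hM (q * x₀) (M₁ + M₂) _ hν' (not_lt.1 hB) x' hx'0 hx'
        rw [sum_mul_gate] at key
        exact key
  | @gate x₀ M₀ μ₀ q₀ hq₀0 hq₀1 h ih =>
    intro q x' hq0 hq1 hx'0 hx'q hx'
    rw [gate_gate, sum_mul_gate, ← mul_assoc]
    exact ih (q * q₀) x' (mul_pos hq0 hq₀0) (by nlinarith) hx'0 (by nlinarith) hx'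
  | @mono x₀ x₁ M₀ μ₀ h hx₁0 hxx ih =>
    intro q x' hq0 hq1 hx'0 hx'q hx'
    exact ih q x' hq0 hq1 hx'0 (hx'q.trans (by nlinarith)) hx'

/-- **THE SPLIT: `TreeBuiltCatHullLight ⟸ (P) ∧ (G) ∧ (M)`** — the light caterpillar-hull node follows from the pair lemma at light floors,
light gates of heavy laws, and heavy laws at light floors (the invariant at the unit outer gate and the declared floor). [this work] -/
theorem treeBuiltCatHullBelow_half_of_split (hP : CatPairLight) (hG : HeavyGateLight) (hM : HeavyBelowHalf) :
    ∀ (x : ℝ) (M : ℕ) (μ : ℕ → ℝ), TreeBuilt x M μ → x < 1 / 2 →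
      InGatedCatHull x (∑ h ∈ Finset.range (M + 1), (h : ℝ) * μ h) M μ := by
  intro x M μ hT hx
  obtain ⟨hx0, -, -, -, -, -⟩ := treeBuilt_lawFacts hT
  have key := treeBuilt_gate_inGatedCatHull_of_split hP hG hM hT 1 x one_pos le_rfl hx0 (by rw [one_mul]) hx
  rwa [gate_one, one_mul] at key

end LawDec
end Quant
end Summit.CriticalPhenomena.PercolationContinuityZ3.Theorems
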